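import Summits.BirchSwinnertonDyer.Rank1Residual.ManinAdditive.KummerDiamondCyclotomic
import Literature.NumberTheory.EllipticCurves.Gamma1ParametrizationCuspGaloisActionProofs
import HarnessLib
import HarnessLib.Audit.Tags

/-!
# THEOREM K inside `ℚ(ζ_N)`, part 2: normalisation helpers (`e^{2πi d/N} = ζ_N^d`, restriction of `σ ∈ Aut_ℚ(ℂ)` to a normal subfield on
# points) and the finite Galois plumbing STEP 2 needs inside `ℚ(ζ_N)` (supply of automorphisms `ζ_N ↦ ζ_N^d`, rationality test)
# — cell `bsd-f2-manin`, seat `-es` g39, MEMO-es §60.7 (LEAD line `kummer_diamond`, stub D6 plumbing); sibling of `KummerDiamondCyclotomic.lean`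

TYPER NOTE (typer g21, T-es-79, part 2 of 2).  SOURCE = HOME/es/g39/KummerDiamondCyclotomic-es-g39.lean sha16 94a97726191eac3d, §4 (section
`Restrict`, ll. 366–421, WITHOUT its closing theorem `cuspInv_galoisAction_of_cyclotomic_galois` — that lemma is the tree's Literature theorem
`optimalGamma1Parametrization_cuspInv_galoisAction_of_cyclotomic`, p761747, imported here so that consumers of this module have it) and §5
(section `Supply`, ll. 423–469) VERBATIM; same namespace `…ManinAdditive.KummerDiamond`, same options/opens as part 1.  Theorem-only (kind
proof); no def, no instance, no sorry; no tree declaration bore these names/statements at landing (LEAD p1's `ComplexAut.exists_complex_algEquiv_exp_pow`,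
p760902, is the `Aut_ℚ(ℂ)`-valued analogue of `exists_aut_cyclotomicSubfield_zetaGen_eq_pow`, a different statement).  HONEST FRAMING: pure
Galois plumbing; nothing about any curve is proved here; E-es-185, C2, Manin c = 1, BSD NOT proved; C2/C3 OPEN.  bears_on: stmt-BirchSwinnertonDyer-22967.
-/

set_option autoImplicit false

noncomputable section

open scoped Classical MatrixGroups ModularForm

open CongruenceSubgroup Complex WeierstrassCurve Literature.NumberTheory.EllipticCurves
  Literature.NumberTheory.EllipticCurves.ModularForms
open Summit.BirchSwinnertonDyer.BirchSwinnertonDyer.Theorems.ManinLocalTwoThree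

namespace Summit.BirchSwinnertonDyer.Rank1Residual.ManinAdditive.KummerDiamond

/-! ### §4. T-es-75 ⟸ T-es-75♭: the cyclotomic form implies the `Aut_ℚ(ℂ)` form by restriction -/

section Restrict

/-- `e^{2πi d/N} = ζ_N^d` for `d : ℤ` (T-es-75's normalisation of `σ(ζ_N)` versus T-es-75♭'s). [folklore] -/
theorem exp_two_pi_I_mul_div_eq_zpow (N : ℕ) (d : ℤ) :
    Complex.exp (2 * Real.pi * Complex.I * d / N) = rootOfUnityExp N ^ d := by
  rw [rootOfUnityExp, ← Complex.exp_int_mul]; congr 1; ring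

/-- For `d : ℤ` there is `e : ℕ` with `ζ_N^d = ζ_N^e` and `e ≡ d (mod N)`. [folklore] -/
theorem exists_nat_rootOfUnityExp_zpow_eq_pow (N : ℕ) [NeZero N] (d : ℤ) :
    ∃ e : ℕ, rootOfUnityExp N ^ d = rootOfUnityExp N ^ e ∧ (e : ℤ) ≡ d [ZMOD N] := by
  have hζ : IsPrimitiveRoot (rootOfUnityExp N) N := Complex.isPrimitiveRoot_exp N (NeZero.ne N)
  have hN : (N : ℤ) ≠ 0 := by exact_mod_cast NeZero.ne N
  have h0 : (0 : ℤ) ≤ d % N := Int.emod_nonneg _ hN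
  refine ⟨(d % N).toNat, ?_, ?_⟩
  · conv_lhs => rw [← Int.mul_ediv_add_emod d N]
    rw [zpow_add₀ (hζ.ne_zero (NeZero.ne N)), zpow_mul, zpow_natCast, hζ.pow_eq_one, one_zpow, one_mul,
      ← zpow_natCast, Int.toNat_of_nonneg h0]
  · rw [Int.toNat_of_nonneg h0]; exact Int.mod_modEq d N

/-- Base change to `ℂ` intertwines `σ ∈ Aut_ℚ(ℂ)` with its restriction to a normal subfield `F ⊂ ℂ`, on `F`-points.
[folklore] -/
theorem map_baseChange_eq_baseChange_map_restrictNormal (F : IntermediateField ℚ ℂ) [Normal ℚ F]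
    (W : WeierstrassCurve ℚ) (σ : ℂ ≃ₐ[ℚ] ℂ) (P : (W.baseChange F).toAffine.Point) :
    Affine.Point.map (W' := W) (σ : ℂ →ₐ[ℚ] ℂ) (Affine.Point.baseChange (W' := W) F ℂ P) =
      Affine.Point.baseChange (W' := W) F ℂ
        (Affine.Point.map (W' := W) (σ.restrictNormal F : F →ₐ[ℚ] F) P) := by
  rcases P with _ | ⟨X, Y, hXY⟩
  · rfl
  · change Affine.Point.some (σ (algebraMap F ℂ X)) (σ (algebraMap F ℂ Y)) _ =
      Affine.Point.some (algebraMap F ℂ (σ.restrictNormal F X)) (algebraMap F ℂ (σ.restrictNormal F Y)) _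
    rw [Affine.Point.some.injEq, AlgEquiv.restrictNormal_commutes, AlgEquiv.restrictNormal_commutes]
    exact ⟨rfl, rfl⟩

/- §4's closing theorem of the source, `cuspInv_galoisAction_of_cyclotomic_galois : optimalGamma1Parametrization_cuspInv_cyclotomic_galois →
optimalGamma1Parametrization_cuspInv_galoisAction` (T-es-75 ⟸ T-es-75♭), is NOT restated: it is the tree's Literature theorem
`Literature.NumberTheory.EllipticCurves.ModularForms.optimalGamma1Parametrization_cuspInv_galoisAction_of_cyclotomic` (ref1 §R222,
`Gamma1ParametrizationCuspGaloisActionProofs.lean`, p761747) — use that name. -/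

end Restrict

/-! ### §5. Finite Galois theory inside `ℚ(ζ_N)`: the supply of automorphisms and the rationality test (D6 plumbing) -/

section Supply

/-- **Galois supply in `ℚ(ζ_N)`.**  For every `d` coprime to `N` there is `σ ∈ Aut_ℚ ℚ(ζ_N)` with `σ(ζ_N) = ζ_N^d`
(`Gal(ℚ(ζ_N)/ℚ) ≅ (ℤ/N)ˣ`, irreducibility of `Φ_N` over `ℚ`): the automorphisms T-es-75♭ / K♭ quantify over EXIST for
every class — STEP 2 can evaluate the Kummer cocycle at every `d`. [folklore] -/
theorem exists_aut_cyclotomicSubfield_zetaGen_eq_pow (N : ℕ) [NeZero N] (d : ℕ) (hd : d.Coprime N) :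
    ∃ σ : cyclotomicSubfield N ≃ₐ[ℚ] cyclotomicSubfield N, (σ (zetaGen N) : ℂ) = rootOfUnityExp N ^ d := by
  haveI hcyc : IsCyclotomicExtension {N} ℚ (cyclotomicSubfield N) := isCyclotomicExtension_cyclotomicSubfield N
  have hζ : IsPrimitiveRoot (rootOfUnityExp N) N := Complex.isPrimitiveRoot_exp N (NeZero.ne N)
  have hζK : IsPrimitiveRoot (zetaGen N) N :=
    hζ.of_map_of_injective (f := algebraMap (cyclotomicSubfield N) ℂ) (algebraMap (cyclotomicSubfield N) ℂ).injective
  have hirr : Irreducible (Polynomial.cyclotomic N ℚ) := Polynomial.cyclotomic.irreducible_rat (NeZero.pos N)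
  have hζKd : IsPrimitiveRoot (zetaGen N ^ d) N := hζK.pow_of_coprime d hd
  refine ⟨(IsCyclotomicExtension.fromZetaAut hζK hirr).symm.trans (IsCyclotomicExtension.fromZetaAut hζKd hirr), ?_⟩
  have h1 : (IsCyclotomicExtension.fromZetaAut hζK hirr).symm (zetaGen N) =
      IsCyclotomicExtension.zeta N ℚ (cyclotomicSubfield N) := by
    rw [AlgEquiv.symm_apply_eq]; exact (IsCyclotomicExtension.fromZetaAut_spec hζK hirr).symm
  rw [AlgEquiv.trans_apply, h1, IsCyclotomicExtension.fromZetaAut_spec]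
  change algebraMap (cyclotomicSubfield N) ℂ (zetaGen N ^ d) = _
  rw [map_pow]; rfl

/-- **Rationality test in `ℚ(ζ_N)`.**  An element of `ℚ(ζ_N) ⊂ ℂ` fixed by every `ℚ`-automorphism of `ℚ(ζ_N)` is rational
(fundamental theorem of Galois theory for the finite Galois extension `ℚ(ζ_N)/ℚ`): the `2`-descent coordinate `w` of the
half point `S` has trivial square class iff `σ(w) = w` for all `σ`. [folklore] -/
theorem exists_ratCast_eq_of_forall_aut_cyclotomicSubfield_fixed (N : ℕ) [NeZero N] (x : cyclotomicSubfield N)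
    (hx : ∀ σ : cyclotomicSubfield N ≃ₐ[ℚ] cyclotomicSubfield N, σ x = x) : ∃ q : ℚ, (x : ℂ) = q := by
  haveI hcyc : IsCyclotomicExtension {N} ℚ (cyclotomicSubfield N) := isCyclotomicExtension_cyclotomicSubfield N
  haveI : FiniteDimensional ℚ (cyclotomicSubfield N) := IsCyclotomicExtension.finite {N} ℚ (cyclotomicSubfield N)
  haveI : IsGalois ℚ (cyclotomicSubfield N) := IsCyclotomicExtension.isGalois {N} ℚ (cyclotomicSubfield N)
  obtain ⟨q, hq⟩ := (IsGalois.mem_range_algebraMap_iff_fixed x).mpr hx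
  refine ⟨q, ?_⟩
  rw [← hq]
  change algebraMap (cyclotomicSubfield N) ℂ (algebraMap ℚ (cyclotomicSubfield N) q) = _
  rw [← IsScalarTower.algebraMap_apply, eq_ratCast]

/-- … and conversely rational elements are fixed (trivial direction, for the iff). [folklore] -/
theorem aut_cyclotomicSubfield_apply_eq_self_of_ratCast (N : ℕ) (x : cyclotomicSubfield N) (q : ℚ)
    (hx : (x : ℂ) = q) (σ : cyclotomicSubfield N ≃ₐ[ℚ] cyclotomicSubfield N) : σ x = x := by
  have hxq : x = algebraMap ℚ (cyclotomicSubfield N) q := by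
    apply (algebraMap (cyclotomicSubfield N) ℂ).injective
    change (x : ℂ) = algebraMap (cyclotomicSubfield N) ℂ (algebraMap ℚ (cyclotomicSubfield N) q)
    rw [← IsScalarTower.algebraMap_apply, eq_ratCast]; exact hx
  rw [hxq, AlgEquiv.commutes]

end Supply

end Summit.BirchSwinnertonDyer.Rank1Residual.ManinAdditive.KummerDiamond

end
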